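import Summits.AtomisticToContinuum.HydrodynamicLimit.Theses.AntiMazurCoboundaries
import Literature.MathematicalPhysics.KineticTheory.HardSphereEulerProofs
import Literature.Analysis.FluidPDE.EmpiricalCollisionMeasure
import Literature.Analysis.FluidPDE.EmpiricalCollisionMeasureMeasurable
import Literature.Analysis.FluidPDE.HardSphereTrajectoryMeasurable
import Mathlib.MeasureTheory.Integral.IntervalIntegral.FundThmCalculus
import Mathlib.MeasureTheory.Integral.Prod

/-!
# One-body Lagrangian observables change only through collision records (stub 4)

Helper file (`--supports stmt-AtomisticToContinuum-14135`) proving the registered stub `stub_collisionTransportIdentity` of the lead's skeleton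
`Cruxes/CorrectorPressureDecay/Lines/kinetic-entropy-collision-budget.lean` (line `kinetic-entropy-collision-budget`) of
the crux `Summit.AtomisticToContinuum.HydrodynamicLimit.Theses.AntiMazurCoboundaries.CorrectorPressureDecay`
(stmt-AtomisticToContinuum-14135, route `AntiMazurCoboundaries`). The statement is spelled over tree primitives exactly
as registered; see the skeleton for the objects it abbreviates (`discAvg`, `optimiser`, `windowOneBodyLaw`, `condKL`,
`fastDev`).

Proof. (1) PATHWISE, for one hard-sphere trajectory `γ` on the flat torus (`collisionTransport_pathwise`): the velocity
`v_i(t) = (γ t i).2` of a particle is constant on every collision-free stretch (free flight, `IsHardSphereTrajectory.free`),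
so for a test `g(t, v)` differentiable in `t` with jointly continuous bounded `∂_t g` one has, on a window `(a, b]`,
`g(b, v_i(b)) − g(a, v_i(a)) = Σ_{records c of i in (a, b]} (g(t_c, v⁺) − g(t_c, v⁻)) + ∫_a^b ∂_t g(t, v_i(t)) dt`:
by strong induction on the (finite) number of collision times in `(a, b]`, peeling off the last one `t*` — on a
collision-free `(a, b]` this is the fundamental theorem of calculus (`collisionTransport_of_free`); on `(m, t*]` with `(m, t*)`
free and `t*` a collision time (`collisionTransport_of_collision`) the ordered contact pairs at `t*` are `(p, q), (q, p)`
(binary collisions; contact is symmetric on the torus, `collisionTransport_swap_mem_contactPairs`), the recorded pre-collisional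
velocities are the velocities at time `m` (`IsHardSphereTrajectory.collidePair_vel_eq`) and a particle not in the pair
keeps its velocity (`collidePair_apply_of_ne`); windows concatenate (`collisionTransport_trans`: `collisionPairSum_union`,
`intervalIntegral.integral_add_adjacent_intervals`, the time integrand being bounded and measurable in `t`).
(2) INTEGRATE over `P`: `P ≪ G_N ≪` Liouville (`localGibbsLaw_eq`, `localGibbsMeasure_absolutelyContinuous`), so the
good set is `P`-conull and the pathwise identity with `g(t, v) := ψ(t, x_i(0), θ^{-1/2}(v − u₀))` holds `P`-a.e.; the
endpoint observables are bounded and measurable, the time integral is bounded and a.e.-measurable (joint measurability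
of the flow on the good set, `HardSphereFlow.measurable_flow_prod_torus`, and Fubini measurability), and the collision
sum is a.e. EQUAL to their combination, hence integrable with the stated integral (`integral_congr_ae`, `integral_sub`).
The integrability hypothesis on the collision count is not needed.
-/

noncomputable section

open MeasureTheory ProbabilityTheory InformationTheory Set Filter Topology
open scoped ENNReal

namespace Summit.AtomisticToContinuum.HydrodynamicLimit.Theorems.KineticEntropyCollisionBudget

open Literature.MathematicalPhysics.KineticTheory (T3 V3 hsDiameter localGibbsLaw)
open Literature.Analysis.FluidPDE (HardSphereFlow Config)

section Pathwise

open Literature.Analysis.FluidPDE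

variable {d : Type*} [Fintype d] {N : ℕ} {ε : ℝ} {γ : ℝ → Config N d (UnitAddTorus d)}

/-- On the flat torus contact is symmetric in the ordered pair, at every diameter (the minimal-image
distance is symmetric, `Torus.euclidDist_comm`). -/
theorem collisionTransport_swap_mem_contactPairs {z : Config N d (UnitAddTorus d)} {p : Fin N × Fin N}
    (hp : p ∈ contactPairs (Torus.geometry d) ε z) : p.swap ∈ contactPairs (Torus.geometry d) ε z := by
  obtain ⟨hne, hD, hdist⟩ := mem_contactPairs.1 hp
  refine mem_contactPairs.2 ⟨hne.symm, hD, ?_⟩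
  rw [Prod.fst_swap, Prod.snd_swap, Torus.norm_geometry_sepVec, Torus.euclidDist_comm,
    ← Torus.norm_geometry_sepVec]
  exact hdist

/-- **Transport identity on a collision-free window.** If `(a, b]` carries no collision time, the velocity
of particle `i` is constant on `[a, b]`, the collision sum over `(a, b]` vanishes, and the identity is the
fundamental theorem of calculus for `s ↦ g s v_i(a)`. -/
theorem collisionTransport_of_free (h : IsHardSphereTrajectory (Torus.geometry d) ε N γ) (i : Fin N)
    (g : ℝ → EuclideanSpace ℝ d → ℝ) (hg : ∀ v, Differentiable ℝ fun s => g s v)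
    (hg' : Continuous (Function.uncurry fun t v => deriv (fun s => g s v) t))
    {a b : ℝ} (hab : a ≤ b) (hfree : ∀ τ ∈ Ioc a b, τ ∉ collisionTimes (Torus.geometry d) ε γ) :
    g b (γ b i).2 - g a (γ a i).2 =
      collisionSum (Torus.geometry d) ε γ (Ioc a b)
          (fun c => if c.fst = i then g c.time c.postVel.1 - g c.time c.preVel.1 else 0) +
        ∫ t in a..b, deriv (fun s => g s (γ t i).2) t := by
  have hvel : ∀ t ∈ Icc a b, (γ t i).2 = (γ a i).2 := fun t ht => by
    rw [h.free a t ht.1 fun τ hτ => hfree τ ⟨hτ.1, hτ.2.trans ht.2⟩, freeFlight_apply]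
  have hsum : collisionSum (Torus.geometry d) ε γ (Ioc a b)
      (fun c => if c.fst = i then g c.time c.postVel.1 - g c.time c.preVel.1 else 0) = 0 :=
    collisionPairSum_eq_zero_of_forall_not_mem (fun t ht => hfree t ht) _
  have hint : ∫ t in a..b, deriv (fun s => g s (γ t i).2) t =
      ∫ t in a..b, deriv (fun s => g s (γ a i).2) t :=
    intervalIntegral.integral_congr fun t ht => by
      rw [uIcc_of_le hab] at ht
      rw [hvel t ht]
  have hftc : ∫ t in a..b, deriv (fun s => g s (γ a i).2) t = g b (γ a i).2 - g a (γ a i).2 :=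
    intervalIntegral.integral_deriv_eq_sub (fun t _ => (hg _).differentiableAt)
      ((hg'.uncurry_right _).intervalIntegrable a b)
  rw [hsum, zero_add, hint, hftc, hvel b ⟨hab, le_rfl⟩]

/-- **Transport identity across one collision.** If `a < b`, `(a, b)` is collision-free and `b` is a
collision time, the velocity of `i` is constant on `[a, b)`; the collision sum over `(a, b]` is the sum over the
two ordered contact pairs `(p, q), (q, p)` at time `b`, whose recorded pre-collisional velocities are the
velocities at time `a` (`IsHardSphereTrajectory.collidePair_vel_eq`); the filter `fst = i` keeps the jump of `i`
if `i ∈ {p, q}` and nothing otherwise, in which case `i` keeps its velocity (`collidePair_apply_of_ne`). -/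
theorem collisionTransport_of_collision (h : IsHardSphereTrajectory (Torus.geometry d) ε N γ) (i : Fin N)
    (g : ℝ → EuclideanSpace ℝ d → ℝ) (hg : ∀ v, Differentiable ℝ fun s => g s v)
    (hg' : Continuous (Function.uncurry fun t v => deriv (fun s => g s v) t))
    {a b : ℝ} (hab : a < b) (hfree : ∀ τ ∈ Ioo a b, τ ∉ collisionTimes (Torus.geometry d) ε γ)
    (hb : b ∈ collisionTimes (Torus.geometry d) ε γ) :
    g b (γ b i).2 - g a (γ a i).2 =
      collisionSum (Torus.geometry d) ε γ (Ioc a b)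
          (fun c => if c.fst = i then g c.time c.postVel.1 - g c.time c.preVel.1 else 0) +
        ∫ t in a..b, deriv (fun s => g s (γ t i).2) t := by
  -- velocities are constant on `[a, b)`
  have hvel : ∀ t ∈ Ico a b, (γ t i).2 = (γ a i).2 := fun t ht => by
    rw [h.eq_freeFlight_of_Ioo_free hfree ht, freeFlight_apply]
  -- the time integral only sees the velocity at time `a`
  have hint : ∫ t in a..b, deriv (fun s => g s (γ t i).2) t =
      ∫ t in a..b, deriv (fun s => g s (γ a i).2) t := by
    refine intervalIntegral.integral_congr_ae ?_
    filter_upwards [(Set.countable_singleton b).ae_notMem volume] with t htb ht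
    rw [uIoc_of_le hab.le] at ht
    rw [mem_singleton_iff] at htb
    rw [hvel t ⟨ht.1.le, lt_of_le_of_ne ht.2 htb⟩]
  have hftc : ∫ t in a..b, deriv (fun s => g s (γ a i).2) t = g b (γ a i).2 - g a (γ a i).2 :=
    intervalIntegral.integral_deriv_eq_sub (fun t _ => (hg _).differentiableAt)
      ((hg'.uncurry_right _).intervalIntegrable a b)
  -- the collision sum is the contribution of the single collision time `b`
  have hset : collisionTimes (Torus.geometry d) ε γ ∩ Ioc a b = {b} := by
    refine Set.eq_singleton_iff_unique_mem.2 ⟨⟨hb, hab, le_rfl⟩, fun t ht => ?_⟩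
    by_contra htb
    exact hfree t ⟨ht.2.1, lt_of_le_of_ne ht.2.2 htb⟩ ht.1
  have hsum : collisionSum (Torus.geometry d) ε γ (Ioc a b)
      (fun c => if c.fst = i then g c.time c.postVel.1 - g c.time c.preVel.1 else 0) =
      ∑ e ∈ contactPairs (Torus.geometry d) ε (γ b),
        if e.1 = i then g b (γ b e.1).2 - g b (collidePair (Torus.geometry d) e.1 e.2 (γ b) e.1).2
        else 0 := by
    rw [collisionSum_eq_collisionPairSum]
    unfold collisionPairSum
    rw [hset, finsum_mem_singleton]
    refine Finset.sum_congr rfl fun e he => ?_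
    simp only [HardSphereCollisionRecord.ofConfig_fst, HardSphereCollisionRecord.ofConfig_time,
      HardSphereCollisionRecord.ofConfig_postVel,
      HardSphereCollisionRecord.ofConfig_preVel_eq_collidePair _ _ _ _ (mem_contactPairs.1 he).1]
  -- the colliding pair, in its two orders
  obtain ⟨⟨p, q⟩, hpq⟩ := mem_collisionTimes_iff_contactPairs_nonempty.1 hb
  have hqp : (q, p) ∈ contactPairs (Torus.geometry d) ε (γ b) :=
    collisionTransport_swap_mem_contactPairs hpq
  obtain ⟨hne, hc⟩ := mem_contactPairs.1 hpq
  obtain ⟨-, hc'⟩ := mem_contactPairs.1 hqp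
  have hpair : contactPairs (Torus.geometry d) ε (γ b) = {(p, q), (q, p)} := by
    ext e
    rw [Finset.mem_insert, Finset.mem_singleton]
    refine ⟨fun he => h.eq_or_eq_of_mem_contactPairs hpq he, ?_⟩
    rintro (rfl | rfl)
    · exact hpq
    · exact hqp
  have hne2 : (p, q) ≠ (q, p) := fun he => hne (Prod.mk.inj he).1
  -- the recorded pre-collisional velocities are the velocities at time `a`
  have hpre : ∀ k, (collidePair (Torus.geometry d) p q (γ b) k).2 = (γ a k).2 :=
    h.collidePair_vel_eq hab hfree hne hc
  have hpre' : ∀ k, (collidePair (Torus.geometry d) q p (γ b) k).2 = (γ a k).2 :=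
    h.collidePair_vel_eq hab hfree hne.symm hc'
  rw [hint, hftc, hsum, hpair, Finset.sum_pair hne2]
  dsimp only
  by_cases hip : p = i
  · have hqi : ¬q = i := fun hqi => hne (hip.trans hqi.symm)
    rw [if_pos hip, if_neg hqi, hpre p, hip]
    ring
  by_cases hiq : q = i
  · rw [if_neg hip, if_pos hiq, hpre' q, hiq]
    ring
  have hvi : (γ b i).2 = (γ a i).2 := by
    rw [← hpre i, collidePair_apply_of_ne (fun h' => hip h'.symm) (fun h' => hiq h'.symm)]
  rw [if_neg hip, if_neg hiq, hvi]
  ring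

/-- **Concatenation of windows.** The transport identity on `(a, m]` and on `(m, b]` give it on `(a, b]`
(additivity of collision sums over disjoint windows and of interval integrals). -/
theorem collisionTransport_trans (h : IsHardSphereTrajectory (Torus.geometry d) ε N γ) (i : Fin N)
    (g : ℝ → EuclideanSpace ℝ d → ℝ)
    (hD : ∀ a b : ℝ, IntervalIntegrable (fun t => deriv (fun s => g s (γ t i).2) t) volume a b)
    {a m b : ℝ} (ham : a ≤ m) (hmb : m ≤ b)
    (h1 : g m (γ m i).2 - g a (γ a i).2 =
      collisionSum (Torus.geometry d) ε γ (Ioc a m)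
          (fun c => if c.fst = i then g c.time c.postVel.1 - g c.time c.preVel.1 else 0) +
        ∫ t in a..m, deriv (fun s => g s (γ t i).2) t)
    (h2 : g b (γ b i).2 - g m (γ m i).2 =
      collisionSum (Torus.geometry d) ε γ (Ioc m b)
          (fun c => if c.fst = i then g c.time c.postVel.1 - g c.time c.preVel.1 else 0) +
        ∫ t in m..b, deriv (fun s => g s (γ t i).2) t) :
    g b (γ b i).2 - g a (γ a i).2 =
      collisionSum (Torus.geometry d) ε γ (Ioc a b)
          (fun c => if c.fst = i then g c.time c.postVel.1 - g c.time c.preVel.1 else 0) +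
        ∫ t in a..b, deriv (fun s => g s (γ t i).2) t := by
  have hS : collisionSum (Torus.geometry d) ε γ (Ioc a b)
      (fun c => if c.fst = i then g c.time c.postVel.1 - g c.time c.preVel.1 else 0) =
      collisionSum (Torus.geometry d) ε γ (Ioc a m)
          (fun c => if c.fst = i then g c.time c.postVel.1 - g c.time c.preVel.1 else 0) +
        collisionSum (Torus.geometry d) ε γ (Ioc m b)
          (fun c => if c.fst = i then g c.time c.postVel.1 - g c.time c.preVel.1 else 0) := by
    rw [collisionSum_eq_collisionPairSum, collisionSum_eq_collisionPairSum,
      collisionSum_eq_collisionPairSum, ← Ioc_union_Ioc_eq_Ioc ham hmb]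
    exact collisionPairSum_union (h.finite_collisionTimes_inter_of_subset_Icc Ioc_subset_Icc_self)
      (h.finite_collisionTimes_inter_of_subset_Icc Ioc_subset_Icc_self)
      (Ioc_disjoint_Ioc_of_le le_rfl) _
  rw [hS, ← intervalIntegral.integral_add_adjacent_intervals (hD a m) (hD m b)]
  linarith

/-- **The pathwise collision-transport identity.** Along a hard-sphere trajectory on the flat torus, for a
test `g(t, v)` differentiable in `t` with jointly continuous, bounded `∂_t g`, the observable `g(t, v_i(t))`
changes over `(a, b]` by the sum over the collision records `c` of particle `i` (ordered records with
`c.fst = i`) of its jumps `g(t_c, v⁺) − g(t_c, v⁻)` plus the integral of its explicit time derivative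
(strong induction on the number of collision times in the window, peeling off the last one). -/
theorem collisionTransport_pathwise (h : IsHardSphereTrajectory (Torus.geometry d) ε N γ) (i : Fin N)
    (g : ℝ → EuclideanSpace ℝ d → ℝ) (hg : ∀ v, Differentiable ℝ fun s => g s v)
    (hg' : Continuous (Function.uncurry fun t v => deriv (fun s => g s v) t))
    (hbdd : ∃ C : ℝ, ∀ t v, |deriv (fun s => g s v) t| ≤ C) {a b : ℝ} (hab : a ≤ b) :
    g b (γ b i).2 - g a (γ a i).2 =
      collisionSum (Torus.geometry d) ε γ (Ioc a b)
          (fun c => if c.fst = i then g c.time c.postVel.1 - g c.time c.preVel.1 else 0) +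
        ∫ t in a..b, deriv (fun s => g s (γ t i).2) t := by
  -- the time integrand is bounded and measurable, hence integrable on every window
  have hD : ∀ a b : ℝ,
      IntervalIntegrable (fun t => deriv (fun s => g s (γ t i).2) t) volume a b := by
    obtain ⟨C, hC⟩ := hbdd
    have hv : Measurable fun t => (γ t i).2 := ((measurable_pi_apply i).comp h.measurable_torus).snd
    have hmeas : Measurable fun t => deriv (fun s => g s (γ t i).2) t :=
      hg'.measurable.comp (measurable_id.prodMk hv)
    intro a b
    refine (intervalIntegrable_const (c := C)).mono_fun' hmeas.aestronglyMeasurable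
      (Eventually.of_forall fun t => (Real.norm_eq_abs _).trans_le (hC t _))
  -- strong induction on the number of collision times in `(a, b]`
  suffices H : ∀ (n : ℕ) (a b : ℝ), a ≤ b →
      (collisionTimes (Torus.geometry d) ε γ ∩ Ioc a b).ncard = n →
      g b (γ b i).2 - g a (γ a i).2 =
        collisionSum (Torus.geometry d) ε γ (Ioc a b)
            (fun c => if c.fst = i then g c.time c.postVel.1 - g c.time c.preVel.1 else 0) +
          ∫ t in a..b, deriv (fun s => g s (γ t i).2) t from H _ a b hab rfl
  intro n
  induction n using Nat.strong_induction_on with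
  | _ n ih =>
    intro a b hab hn
    by_cases hemp : collisionTimes (Torus.geometry d) ε γ ∩ Ioc a b = ∅
    · exact collisionTransport_of_free h i g hg hg' hab fun τ hτ hτc =>
        (Set.eq_empty_iff_forall_notMem.1 hemp) τ ⟨hτc, hτ⟩
    have hfin : (collisionTimes (Torus.geometry d) ε γ ∩ Ioc a b).Finite :=
      h.finite_collisionTimes_inter_of_subset_Icc Ioc_subset_Icc_self
    -- the last collision time `ts` in `(a, b]` and a collision-free stretch `(s, ts)` before it
    obtain ⟨ts, hts, hmax⟩ :=
      Set.exists_max_image _ (fun x => x) hfin (Set.nonempty_iff_ne_empty.2 hemp)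
    obtain ⟨s, hs, hsfree⟩ := h.exists_Ioo_left_free ts
    have hm_lt : max s a < ts := max_lt hs hts.2.1
    have ham : a ≤ max s a := le_max_right _ _
    have hmb : max s a ≤ b := hm_lt.le.trans hts.2.2
    -- `(max s a, ts]`: one collision, at `ts`
    have h2 := collisionTransport_of_collision h i g hg hg' hm_lt
      (fun τ hτ => hsfree τ ⟨(le_max_left _ _).trans_lt hτ.1, hτ.2⟩) hts.1
    -- `(ts, b]`: collision-free
    have h3 := collisionTransport_of_free h i g hg hg' hts.2.2 fun τ hτ hτc =>
      (not_le.2 hτ.1) (hmax τ ⟨hτc, hts.2.1.trans hτ.1, hτ.2⟩)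
    -- `(a, max s a]`: fewer collision times
    have hlt : (collisionTimes (Torus.geometry d) ε γ ∩ Ioc a (max s a)).ncard < n := by
      rw [← hn]
      refine Set.ncard_lt_ncard ⟨inter_subset_inter_right _ (Ioc_subset_Ioc_right hmb), fun hsub => ?_⟩
        hfin
      exact (not_le.2 hm_lt) (hsub hts).2.2
    have h1 := ih _ hlt a (max s a) ham rfl
    exact collisionTransport_trans h i g hD ham hmb h1
      (collisionTransport_trans h i g hD hm_lt.le hts.2.2 h2 h3)

end Pathwise

open Literature.MathematicalPhysics.KineticTheory (localGibbsLaw_eq localGibbsMeasure_absolutelyContinuous)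

/-- **Registered stub `stub_collisionTransportIdentity`** (line `kinetic-entropy-collision-budget`, crux stmt-AtomisticToContinuum-14135): under a law `P ≪ G_N` with integrable collision count on `(0,T]`, `E_P[ψ(T,x_i(0),ṽ_i(T))] − E_P[ψ(0,x_i(0),ṽ_i(0))]` equals the expected sum over the records of particle `i` of the jumps of `ψ` plus `E_P ∫₀ᵀ ∂_tψ`. -/
theorem stub_collisionTransportIdentity :
    ∀ (σ a θ : ℝ) (u₀ : V3), 0 < σ → σ ≤ 1 / 2 → 0 < a → 0 < θ →
      ∀ (N : ℕ) (Φ : HardSphereFlow (Literature.Analysis.FluidPDE.Torus.geometry (Fin 3)) (hsDiameter σ N) (N + 1)) (P : Measure (Config (N + 1) (Fin 3) T3)),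
        IsProbabilityMeasure P → P ≪ localGibbsLaw σ (fun _ => a) (fun _ => u₀) (fun _ => θ) N Φ →
        ∀ T : ℝ, 0 ≤ T →
          Integrable (fun z => Φ.collisionSum (Set.Ioc 0 T) (fun _ => (1 : ℝ)) z) P →
          ∀ (i : Fin (N + 1)) (ψ : ℝ → T3 × V3 → ℝ),
            Continuous (Function.uncurry ψ) → (∃ C : ℝ, ∀ t p, |ψ t p| ≤ C) →
            (∀ p, Differentiable ℝ (fun t => ψ t p)) →
            Continuous (Function.uncurry fun t p => deriv (fun s => ψ s p) t) →
            (∃ C : ℝ, ∀ t p, |deriv (fun s => ψ s p) t| ≤ C) →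
            (∫ z, ψ T ((z i).1, (Real.sqrt θ)⁻¹ • ((Φ.flow T z i).2 - u₀)) ∂P) -
                ∫ z, ψ 0 ((z i).1, (Real.sqrt θ)⁻¹ • ((Φ.flow 0 z i).2 - u₀)) ∂P =
              (∫ z, Φ.collisionSum (Set.Ioc 0 T)
                  (fun c => if c.fst = i then
                      ψ c.time ((z i).1, (Real.sqrt θ)⁻¹ • (c.postVel.1 - u₀)) -
                        ψ c.time ((z i).1, (Real.sqrt θ)⁻¹ • (c.preVel.1 - u₀))
                    else 0) z ∂P) +
                ∫ z, (∫ t in (0 : ℝ)..T,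
                  deriv (fun s => ψ s ((z i).1, (Real.sqrt θ)⁻¹ • ((Φ.flow t z i).2 - u₀))) t) ∂P := by
  intro σ a θ u₀ _hσ _hσ2 _ha _hθ N Φ P _hP hPG T hT _hcount i ψ hψc hψb hψd hψ'c hψ'b
  obtain ⟨C, hC⟩ := hψb
  obtain ⟨C', hC'⟩ := hψ'b
  -- `P` is carried by the good set of the flow
  have hPL : P ≪ Literature.Analysis.FluidPDE.liouville
      (Literature.Analysis.FluidPDE.Torus.geometry (Fin 3)) (N + 1) (hsDiameter σ N) := by
    refine hPG.trans ?_
    rw [localGibbsLaw_eq]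
    exact localGibbsMeasure_absolutelyContinuous σ _ _ _ N Φ
  have hgood : ∀ᵐ z ∂P, z ∈ Φ.good := hPL.ae_le Φ.ae_mem_good
  have hPgood : P Φ.goodᶜ = 0 := hPL Φ.measure_compl_good
  -- (1) the pathwise identity, `P`-almost everywhere
  have hpath : (fun z => Φ.collisionSum (Set.Ioc 0 T)
        (fun c => if c.fst = i then
            ψ c.time ((z i).1, (Real.sqrt θ)⁻¹ • (c.postVel.1 - u₀)) -
              ψ c.time ((z i).1, (Real.sqrt θ)⁻¹ • (c.preVel.1 - u₀))
          else 0) z) =ᵐ[P]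
      fun z => ψ T ((z i).1, (Real.sqrt θ)⁻¹ • ((Φ.flow T z i).2 - u₀)) -
          ψ 0 ((z i).1, (Real.sqrt θ)⁻¹ • ((Φ.flow 0 z i).2 - u₀)) -
        ∫ t in (0 : ℝ)..T,
          deriv (fun s => ψ s ((z i).1, (Real.sqrt θ)⁻¹ • ((Φ.flow t z i).2 - u₀))) t := by
    filter_upwards [hgood] with z hz
    have hg : ∀ v : V3, Differentiable ℝ fun s => ψ s ((z i).1, (Real.sqrt θ)⁻¹ • (v - u₀)) :=
      fun v => hψd _
    have hg' : Continuous (Function.uncurry fun t (v : V3) =>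
        deriv (fun s => ψ s ((z i).1, (Real.sqrt θ)⁻¹ • (v - u₀))) t) := by
      have h1 : Continuous fun q : ℝ × V3 => (q.1, ((z i).1, (Real.sqrt θ)⁻¹ • (q.2 - u₀))) := by
        fun_prop
      exact hψ'c.comp h1
    have hbdd : ∃ C : ℝ, ∀ (t : ℝ) (v : V3),
        |deriv (fun s => ψ s ((z i).1, (Real.sqrt θ)⁻¹ • (v - u₀))) t| ≤ C :=
      ⟨C', fun t v => hC' t _⟩
    have key := collisionTransport_pathwise (Φ.isTrajectory z hz) i
      (fun t v => ψ t ((z i).1, (Real.sqrt θ)⁻¹ • (v - u₀))) hg hg' hbdd hT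
    beta_reduce at key
    rw [HardSphereFlow.collisionSum_eq]
    linarith [key]
  -- (2) integrability of the endpoint observables and of the time integral
  have hmeas_obs : ∀ t : ℝ, Measurable fun z : Config (N + 1) (Fin 3) T3 =>
      ψ t ((z i).1, (Real.sqrt θ)⁻¹ • ((Φ.flow t z i).2 - u₀)) := by
    intro t
    have hft := Φ.measurable_flow t
    have h1 : Measurable fun z : Config (N + 1) (Fin 3) T3 =>
        ((z i).1, (Real.sqrt θ)⁻¹ • ((Φ.flow t z i).2 - u₀)) :=
      (measurable_pi_apply i).fst.prodMk
        ((measurable_const_smul _).comp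
          ((((measurable_pi_apply i).comp hft).snd).sub measurable_const))
    exact (hψc.uncurry_left t).measurable.comp h1
  have hint_obs : ∀ t : ℝ, Integrable (fun z : Config (N + 1) (Fin 3) T3 =>
      ψ t ((z i).1, (Real.sqrt θ)⁻¹ • ((Φ.flow t z i).2 - u₀))) P := fun t =>
    (integrable_const C).mono' (hmeas_obs t).aestronglyMeasurable
      (Eventually.of_forall fun z => by rw [Real.norm_eq_abs]; exact hC _ _)
  have hmeas_I : AEStronglyMeasurable (fun z : Config (N + 1) (Fin 3) T3 => ∫ t in (0 : ℝ)..T,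
      deriv (fun s => ψ s ((z i).1, (Real.sqrt θ)⁻¹ • ((Φ.flow t z i).2 - u₀))) t) P := by
    have hj := Φ.measurable_flow_prod_torus
    have h1 : Measurable fun q : Φ.good × ℝ =>
        (q.2, (((q.1 : Config (N + 1) (Fin 3) T3) i).1,
          (Real.sqrt θ)⁻¹ • ((Φ.flow q.2 (q.1 : Config (N + 1) (Fin 3) T3) i).2 - u₀))) :=
      measurable_snd.prodMk
        (((measurable_pi_apply i).comp (measurable_subtype_coe.comp measurable_fst)).fst.prodMk
          ((measurable_const_smul _).comp
            ((((measurable_pi_apply i).comp hj).snd).sub measurable_const)))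
    have hH : Measurable fun q : Φ.good × ℝ =>
        deriv (fun s => ψ s (((q.1 : Config (N + 1) (Fin 3) T3) i).1,
          (Real.sqrt θ)⁻¹ • ((Φ.flow q.2 (q.1 : Config (N + 1) (Fin 3) T3) i).2 - u₀))) q.2 :=
      hψ'c.measurable.comp h1
    have hSM : StronglyMeasurable fun zg : Φ.good => ∫ t in (0 : ℝ)..T,
        deriv (fun s => ψ s (((zg : Config (N + 1) (Fin 3) T3) i).1,
          (Real.sqrt θ)⁻¹ • ((Φ.flow t (zg : Config (N + 1) (Fin 3) T3) i).2 - u₀))) t := by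
      simp only [intervalIntegral.integral_of_le hT]
      exact StronglyMeasurable.integral_prod_right
        (f := fun (zg : Φ.good) (t : ℝ) =>
          deriv (fun s => ψ s (((zg : Config (N + 1) (Fin 3) T3) i).1,
            (Real.sqrt θ)⁻¹ • ((Φ.flow t (zg : Config (N + 1) (Fin 3) T3) i).2 - u₀))) t)
        hH.stronglyMeasurable
    exact (Φ.aemeasurable_of_measurable_comp_subtype hSM.measurable hPgood).aestronglyMeasurable
  have hint_I : Integrable (fun z : Config (N + 1) (Fin 3) T3 => ∫ t in (0 : ℝ)..T,
      deriv (fun s => ψ s ((z i).1, (Real.sqrt θ)⁻¹ • ((Φ.flow t z i).2 - u₀))) t) P :=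
    (integrable_const (C' * |T - 0|)).mono' hmeas_I (Eventually.of_forall fun z =>
      intervalIntegral.norm_integral_le_of_norm_le_const fun t _ => by
        rw [Real.norm_eq_abs]; exact hC' _ _)
  -- (3) integrate the a.e. identity
  have hS := integral_congr_ae hpath
  rw [integral_sub ((hint_obs T).sub' (hint_obs 0)) hint_I,
    integral_sub (hint_obs T) (hint_obs 0)] at hS
  linarith

end Summit.AtomisticToContinuum.HydrodynamicLimit.Theorems.KineticEntropyCollisionBudget

end
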